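import Mathlib
import Summits.Langlands.Langlands.Theses.PicardMuOrdinary
import Literature.NumberTheory.GaloisRepresentations.CubicResidueSymbol
import Literature.NumberTheory.GaloisRepresentations.GaloisRep
import Literature.NumberTheory.GaloisRepresentations.OrdinaryRegular
import Literature.NumberTheory.GaloisRepresentations.LocalClassFieldTheory
import Literature.NumberTheory.GaloisRepresentations.LocalClassFieldTheoryDischargeProofs
import Literature.NumberTheory.Automorphic.ReciprocityGLn
import Literature.NumberTheory.Automorphic.ReciprocityGLnProofs
import Literature.NumberTheory.Automorphic.AsaiSign
import Literature.NumberTheory.Automorphic.BaseChangeUnramifiedLift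
import HarnessLib

/-!
# Route `PicardMuOrdinary`, crux `IrregularClassicality` (stmt-Langlands-13758): vocabulary and open
# statements of the line `split-ramified-prime-sqrt6`

Route-posited objects (D-0016 `<Route>Defs`-type file; continuation lead prover-line-stmt-Langlands-13758-c4-0,
2026-08-16) shared by the registered stubs of the checked skeleton
`Cruxes/IrregularClassicality/Lines/split_ramified_prime_sqrt6.lean` (reshape r9 of lead c3, re-registered by this lead:
stubs `stub_picardCurveGaloisRep`, `stub_ordinaryPolarizedTwistedTower`, `stub_baseChangeFacts`,
`stub_twoWallOrdinaryClassicalityOrd`, `stub_basicRemainder`), by the conditional reduction file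
`PicardMuOrdinaryIrregularClassicalityReduction.lean`, and by the restate / re-route kit of leads c1–c3 (so far only in
the crux workfiles `Lines/split_ramified_prime_sqrt6_restated_ord.lean`, `Lines/split_ramified_prime_sqrt6_route_ord.lean`,
where this vocabulary was declared THREE times in three namespaces).  NOTHING IS ASSERTED here: every `def … : Prop`
below is a *statement*, consumed only as (part of) the type of a stub theorem, of the crux, or of a restated item.
Declared in the namespace of the line's landed stubs
(`Summit.Langlands.Langlands.Theorems.IrregularClassicality.SplitRamifiedPrimeSqrt6`); the skeleton `open`s it, so the
registered stub signatures read byte-identically.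

Contents (statements VERBATIM from the registered skeleton r9 and the two kit files; only docstrings are new):

* §0 `ArtinData` (local Artin data at every finite place of `K = ℚ(ω)`, a parameter as everywhere in the tree) and
  `nonempty_artinData` (the tree's discharged local class field theory);
* §1 the ALIGNED μ-ordinarity guard of reshape r7: `IsAlignedWeight`, `MuOrdinaryGaloisGuard art ρ`, and the `K`-side
  ORDINARY exactly-polarized tower `OrdPolarizedTower art hcpt ι c₀ S a` (members regular algebraic, `c₀`-conjugate
  self-dual, Galois-compatible off `S` with an avatar `r_k` ordinary at `λ` of a dominant labelled weight, congruent to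
  the trace function `a` to depth `k` in the `ι`-currency);
* §2 the interface shapes: `TwistedPicardWitness` (output of the landed Stub 2), `AutomorphyConclusion` (the crux's /
  target's conclusion at `f`), `ResidualHyp` (13757's hypothesis), `LimitHypothesis` (the crux's hypothesis = 13757's
  conclusion, as typed), `OrdTwistedPolarizedLimitHypothesis art f hcpt` (the ORDINARY twisted-polarized restate of that
  interface, lead c1), `MuOrdinaryClass art f` (the aligned μ-ordinary class at `f`-level, lead c2);
* §3 the three OPEN registered stub statements as named propositions: `OrdinaryPolarizedTwistedTowerDebt`
  (= `stub_ordinaryPolarizedTwistedTower`, the interface debt), `TwoWallOrdinaryClassicalityLinked`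
  (= `stub_twoWallOrdinaryClassicalityOrd` v2, THE open theorem of the line — the statement to promote), `BasicRemainder`
  (= `stub_basicRemainder`, the conceded λ-basic class);
* §4 the restated items of the re-route kit: `IrregularClassicalityOrd` (13758ᵒʳᵈ), `MuOrdinaryFamilyRTOrd` (13757ᵒʳᵈ),
  `BasicLocusAutomorphy` (third branch).

Design notes: the reshape history r1–r9 and the mathematics behind each shape are in the skeleton's module docstring and
in `Lines/split_ramified_prime_sqrt6_reshape_r7.md`, `…_reshape_r8_r9.md`; conventions as in the landed stubs (traces of
`Frob⁻¹` at ARITHMETIC Frobenii `IsArithFrobAt`; `N𝔭·ΣSat` for regular members via `IsGaloisCompatibleAt` (`m = n = 3`);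
`arithFrobPolyOfSatake ι q 1 α` for the L-algebraic output).  Deliberately NOT here: any curve-level reduction predicate
(the r1 guard `HasMuOrdinaryReductionAtThree` is EMPTY on `ℤ[X]`, Börner–Bouw–Wewers 2017 §3.2), any `Nodup`/distinguished
clause on unit roots (drefute g2 §3), Hodge–Tate / de Rham data of the abstract `ρ` (period-ring data are parameters in
the tree; a de Rham clause on abstract data would be vacuous or false).
-/

-- `Summit.Langlands.Langlands.…` (summit = sub-problem name, D-0017 layout) trips `dupNamespace` on every decl.
set_option linter.dupNamespace false
set_option autoImplicit false

namespace Summit.Langlands.Langlands.Theorems.IrregularClassicality.SplitRamifiedPrimeSqrt6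

open scoped NumberField Polynomial Classical
open IsDedekindDomain NumberField Polynomial
open Literature.NumberTheory.GaloisRepresentations Literature.NumberTheory.Automorphic

noncomputable section

/-! ## 0. Local Artin data -/

/-- A choice of local Artin datum at every finite place of `K = ℚ(ω)` (a parameter, as everywhere in the tree:
`LocalArtinData` is local class field theory's Artin map packaged as data). -/
abbrev ArtinData : Type :=
  ∀ v : HeightOneSpectrum (𝓞 (CyclotomicField 3 ℚ)), LocalArtinData (v.adicCompletion (CyclotomicField 3 ℚ))

/-- Local Artin data exist (the tree's discharged local class field theory `nonempty_localArtinData_at`), so a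
`∀ art` binder in a restated item never quantifies over an empty type. -/
theorem nonempty_artinData : Nonempty ArtinData :=
  ⟨fun v => Classical.choice (nonempty_localArtinData_at (v.adicCompletion (CyclotomicField 3 ℚ)))⟩

/-! ## 1. The aligned μ-ordinarity guard and ordinary polarized towers (reshape r6/r7) -/

/-- **Aligned labelled weights.**  A labelled weight `wt` of rank `3` at a place `v` is ALIGNED when, at every label
`τ : K_v → ℚ̄₃`, the tree's ordinary Hodge–Tate weights `i ↦ wt τ i.rev + i` of the diagonal characters of an ordinary
representation of weight `wt` are WEAKLY increasing along the rows of the flag — the closure of the tree's dominance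
(`LabelledWeight.IsDominant` makes the same maps strictly increasing).  It separates the μ-ordinary twisted Picard
representation (flag `mult ⊂ connected ⊂ all`, weights weakly monotone in the same direction at both labels) from the
split-basic CM points such as `f₆₇` (full flags by de Rham characters exist but are anti-aligned; reshape-r7 note). -/
def IsAlignedWeight {v : HeightOneSpectrum (𝓞 (CyclotomicField 3 ℚ))}
    (wt : LabelledWeight (v.adicCompletion (CyclotomicField 3 ℚ)) (PadicAlgCl 3) 3) : Prop :=
  ∀ τ : HodgeTateLabel (v.adicCompletion (CyclotomicField 3 ℚ)) (PadicAlgCl 3),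
    Monotone fun i : Fin 3 => wt τ i.rev + (i : ℤ)

/-- Dominant labelled weights are aligned (`StrictMono → Monotone`). -/
theorem isAlignedWeight_of_isDominant {v : HeightOneSpectrum (𝓞 (CyclotomicField 3 ℚ))}
    {wt : LabelledWeight (v.adicCompletion (CyclotomicField 3 ℚ)) (PadicAlgCl 3) 3}
    (h : wt.IsDominant) : IsAlignedWeight wt :=
  fun τ => (h.strictMono τ).monotone

/-- **The Galois-side μ-ordinarity guard, ALIGNED form** (reshape r7).  At some place `v ∣ 3` of `K` (there is exactly
one, `λ`), `ρ|_{Γ_{K_v}}` is ordinary (`FramedGaloisRep.IsOrdinaryOfLabelledWeightAt`, relative to `art v`) of some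
ALIGNED labelled weight.  For `ρ = ρ'_C = ρ_C ⊗ ψ` this reads "`J(C_f)` is μ-ordinary or (potentially) multiplicative at
`3`" (BBW stable types (b)–(e); non-empty: `f = 3x⁴ + x³ − 54`), and it fails on the λ-basic class. -/
def MuOrdinaryGaloisGuard (art : ArtinData)
    (ρ : FramedGaloisRep (CyclotomicField 3 ℚ) (PadicAlgCl 3) 3) : Prop :=
  ∃ v : HeightOneSpectrum (𝓞 (CyclotomicField 3 ℚ)), ((3 : ℕ) : 𝓞 (CyclotomicField 3 ℚ)) ∈ v.asIdeal ∧
    ∃ wt : LabelledWeight (v.adicCompletion (CyclotomicField 3 ℚ)) (PadicAlgCl 3) 3,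
      IsAlignedWeight wt ∧ ρ.IsOrdinaryOfLabelledWeightAt v (art v) wt

/-- A representation ordinary of DOMINANT weight at a place above `3` (the avatars' condition) passes the aligned
guard. -/
theorem muOrdinaryGaloisGuard_of_isDominant {art : ArtinData}
    {ρ : FramedGaloisRep (CyclotomicField 3 ℚ) (PadicAlgCl 3) 3}
    {v : HeightOneSpectrum (𝓞 (CyclotomicField 3 ℚ))}
    (hv : ((3 : ℕ) : 𝓞 (CyclotomicField 3 ℚ)) ∈ v.asIdeal)
    {wt : LabelledWeight (v.adicCompletion (CyclotomicField 3 ℚ)) (PadicAlgCl 3) 3}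
    (hwt : wt.IsDominant) (hρ : ρ.IsOrdinaryOfLabelledWeightAt v (art v) wt) :
    MuOrdinaryGaloisGuard art ρ :=
  ⟨v, hv, wt, isAlignedWeight_of_isDominant hwt, hρ⟩

/-- **A `K`-side ORDINARY polarized tower** for the trace function `a` off `S`, read through `ι`: for every depth `k`
a regular algebraic, exactly `c₀`-conjugate-self-dual cuspidal `Π` on `GL₃(𝔸_K)` with a Galois representation
`r : Γ_K → GL₃(ℚ̄₃)`, unramified and Galois-compatible off `S` (`IsGaloisCompatibleAt`, `m = n = 3`), ORDINARY at every
`v ∣ 3` of some dominant labelled weight relative to `art v` (the AVATAR), and `‖ι⁻¹(N𝔭·ΣSat(Π,𝔭) − a 𝔭)‖ ≤ 3^{-k}`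
off `S` with `N𝔭·ΣSat(Π,𝔭) − a 𝔭 ∈ ℤ̄`. -/
def OrdPolarizedTower (art : ArtinData) (hcpt : isCompact_glFiniteIntegralLevel 3 (CyclotomicField 3 ℚ))
    (ι : PadicAlgCl 3 ≃+* ℂ) (c₀ : CyclotomicField 3 ℚ ≃ₐ[ℚ] CyclotomicField 3 ℚ)
    (S : Finset (HeightOneSpectrum (𝓞 (CyclotomicField 3 ℚ))))
    (a : HeightOneSpectrum (𝓞 (CyclotomicField 3 ℚ)) → ℂ) : Prop :=
  ∀ k : ℕ, ∃ (P : CuspidalAutomorphicRepData 3 (CyclotomicField 3 ℚ) hcpt)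
    (r : FramedGaloisRep (CyclotomicField 3 ℚ) (PadicAlgCl 3) 3),
    P.1.IsRegularAlgebraic ∧ P.1.IsConjSelfDualAE c₀ ∧
    (∀ 𝔭 ∉ S, P.1.IsUnramifiedAt 𝔭 ∧ IsGaloisCompatibleAt P.1 ι r 𝔭 ∧
      ∃ (α : Multiset ℂ) (t : integralClosure ℤ ℂ), P.1.HasSatakeParamAt 𝔭 α ∧
        (t : ℂ) = (𝔭.residueCard : ℂ) * α.sum - a 𝔭 ∧ ‖ι.symm (t : ℂ)‖ ≤ ((3 : ℝ)⁻¹) ^ k) ∧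
    ∀ v : HeightOneSpectrum (𝓞 (CyclotomicField 3 ℚ)),
      ((3 : ℕ) : 𝓞 (CyclotomicField 3 ℚ)) ∈ v.asIdeal →
      ∃ wt : LabelledWeight (v.adicCompletion (CyclotomicField 3 ℚ)) (PadicAlgCl 3) 3,
        wt.IsDominant ∧ r.IsOrdinaryOfLabelledWeightAt v (art v) wt

/-! ## 2. Interface shapes -/

/-- **Twisted Picard witness** (the output shape of the landed Stub 2 `stub_twistedPicardGaloisInput`): `S₀` contains
the places above `3`; off `S₀`, `ϖ_𝔭` is the PRIMARY generator of `𝔭` (`𝔭 = (ϖ_𝔭)`, `ϖ_𝔭 ≡ 1 mod 3`) and `ρ` is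
unramified with trace `ι⁻¹ e(a_𝔭(f)·ϖ_𝔭)` at `Frob⁻¹` for arithmetic Frobenii.  On paper this pins `ρ ≅ ρ'_C = ρ_C ⊗ ψ`
read through `(ι, e)` (Chebotarev + Brauer–Nesbitt). -/
def TwistedPicardWitness (f : ℤ[X]) (ι : PadicAlgCl 3 ≃+* ℂ) (e : CyclotomicField 3 ℚ →+* ℂ)
    (S₀ : Finset (HeightOneSpectrum (𝓞 (CyclotomicField 3 ℚ))))
    (ϖ : HeightOneSpectrum (𝓞 (CyclotomicField 3 ℚ)) → 𝓞 (CyclotomicField 3 ℚ))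
    (ρ : FramedGaloisRep (CyclotomicField 3 ℚ) (PadicAlgCl 3) 3) : Prop :=
  (∀ v : HeightOneSpectrum (𝓞 (CyclotomicField 3 ℚ)),
    ((3 : ℕ) : 𝓞 (CyclotomicField 3 ℚ)) ∈ v.asIdeal → v ∈ S₀) ∧
  ∀ 𝔭 ∉ S₀,
    (𝔭.asIdeal = Ideal.span {ϖ 𝔭} ∧ ϖ 𝔭 - 1 ∈ Ideal.span {(3 : 𝓞 (CyclotomicField 3 ℚ))}) ∧
    ρ.IsUnramifiedAt 𝔭 ∧
    ∀ 𝔓 ∈ 𝔭.primesAbove, ∀ τ : Field.absoluteGaloisGroup (CyclotomicField 3 ℚ),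
      IsArithFrobAt (𝓞 (CyclotomicField 3 ℚ)) τ 𝔓 →
        FramedRep.trace ρ τ⁻¹ = ι.symm (e (↑(picardTrace f 𝔭 * ϖ 𝔭)))

/-- The conclusion of the crux at `f`, `hcpt` (VERBATIM the conclusion of `IrregularClassicality` and of the target
`PicardAutomorphy`): a cuspidal L-algebraic `π` on `GL₃(𝔸_K)` with `Σ Sat(π, 𝔭) = e(a_𝔭(f))` for almost all `𝔭`. -/
def AutomorphyConclusion (f : ℤ[X]) (hcpt : isCompact_glFiniteIntegralLevel 3 (CyclotomicField 3 ℚ)) :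
    Prop :=
  ∃ (e : CyclotomicField 3 ℚ →+* ℂ) (π : CuspidalAutomorphicRepData 3 (CyclotomicField 3 ℚ) hcpt),
    π.1.IsLAlgebraic ∧
    ∀ᶠ 𝔭 : HeightOneSpectrum (𝓞 (CyclotomicField 3 ℚ)) in Filter.cofinite,
      ∃ α : Multiset ℂ, π.1.HasSatakeParamAt 𝔭 α ∧ α.sum = e (picardTrace f 𝔭)

/-- The residual-automorphy hypothesis of 13757 (VERBATIM the parenthesised hypothesis of `MuOrdinaryFamilyRT` = the
conclusion of `ResidualAutomorphyOdd` / `ResidualAutomorphyEven`). -/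
def ResidualHyp (f : ℤ[X]) (hcpt : isCompact_glFiniteIntegralLevel 3 (CyclotomicField 3 ℚ)) : Prop :=
  ∃ (P : Literature.NumberTheory.Automorphic.CuspidalAutomorphicRepData 3 (CyclotomicField 3 ℚ) hcpt) (𝔐 : Ideal (integralClosure ℤ ℂ)), P.1.IsRegularAlgebraic ∧ 𝔐.IsMaximal ∧ (3 : (integralClosure ℤ ℂ)) ∈ 𝔐 ∧ ∀ᶠ 𝔭 : IsDedekindDomain.HeightOneSpectrum (NumberField.RingOfIntegers (CyclotomicField 3 ℚ)) in Filter.cofinite, ∃ (α : Multiset ℂ) (Q : Polynomial (integralClosure ℤ ℂ)), P.1.HasSatakeParamAt 𝔭 α ∧ Q.map (algebraMap (integralClosure ℤ ℂ) ℂ) = (α.map (fun a => Polynomial.X - Polynomial.C ((𝔭.residueCard : ℂ) * a))).prod ∧ Q.map (Ideal.Quotient.mk 𝔐) = (if (f.map ((Ideal.Quotient.mk 𝔭.asIdeal).comp (algebraMap ℤ (NumberField.RingOfIntegers (CyclotomicField 3 ℚ))))).roots.toFinset.card = 4 then (Polynomial.X - 1) ^ 3 else if (f.map ((Ideal.Quotient.mk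 𝔭.asIdeal).comp (algebraMap ℤ (NumberField.RingOfIntegers (CyclotomicField 3 ℚ))))).roots.toFinset.card = 2 then (Polynomial.X - 1) ^ 2 * (Polynomial.X + 1) else if (f.map ((Ideal.Quotient.mk 𝔭.asIdeal).comp (algebraMap ℤ (NumberField.RingOfIntegers (CyclotomicField 3 ℚ))))).roots.toFinset.card = 1 then Polynomial.X ^ 3 - 1 else if (∃ y : ((NumberField.RingOfIntegers (CyclotomicField 3 ℚ)) ⧸ 𝔭.asIdeal), y ^ 2 = (f.map ((Ideal.Quotient.mk 𝔭.asIdeal).comp (algebraMap ℤ (NumberField.RingOfIntegers (CyclotomicField 3 ℚ))))).discr) then (Polynomial.X - 1) * (Polynomial.X + 1) ^ 2 else Polynomial.X ^ 3 + Polynomial.X ^ 2 + Polynomial.X + 1 : Polynomial ℤ).map (Int.castRingHom ((integralClosure ℤ ℂ) ⧸ 𝔐))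

/-- The limit hypothesis of the crux AS TYPED (VERBATIM the parenthesised hypothesis of `IrregularClassicality` = the
conclusion of `MuOrdinaryFamilyRT`): `ρ_C` is a `3`-adic limit, in Frobenius traces off a finite `S`, of regular
algebraic cuspidal `P_k` — slope-free and unpolarized. -/
def LimitHypothesis (f : ℤ[X]) (hcpt : isCompact_glFiniteIntegralLevel 3 (CyclotomicField 3 ℚ)) : Prop :=
  ∃ (e : CyclotomicField 3 ℚ →+* ℂ) (𝔐 : Ideal (integralClosure ℤ ℂ))
    (S : Finset (HeightOneSpectrum (𝓞 (CyclotomicField 3 ℚ)))), 𝔐.IsMaximal ∧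
    (3 : integralClosure ℤ ℂ) ∈ 𝔐 ∧ ∀ k : ℕ,
    ∃ P : CuspidalAutomorphicRepData 3 (CyclotomicField 3 ℚ) hcpt, P.1.IsRegularAlgebraic ∧
      ∀ 𝔭 ∉ S, ∃ (α : Multiset ℂ) (t u : integralClosure ℤ ℂ), P.1.HasSatakeParamAt 𝔭 α ∧
        (t : ℂ) = (𝔭.residueCard : ℂ) * α.sum - e (picardTrace f 𝔭) ∧ u ∉ 𝔐 ∧
        u * t ∈ Ideal.span {(3 : integralClosure ℤ ℂ) ^ k}

/-- **The ORDINARY twisted-polarized limit hypothesis** (lead c1; the 13757 → 13758 interface in final normal form,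
`ι`-currency): an embedding `e`, an isomorphism `ι : ℚ̄₃ ≃ ℂ`, a finite `S`, complex conjugation `c₀ ≠ 1`, primary
generators `ϖ` off `S`, and an ORDINARY `c₀`-polarized tower for the twisted traces `e(a_𝔭(f)·ϖ_𝔭)` off `S`. -/
def OrdTwistedPolarizedLimitHypothesis (art : ArtinData) (f : ℤ[X])
    (hcpt : isCompact_glFiniteIntegralLevel 3 (CyclotomicField 3 ℚ)) : Prop :=
  ∃ (e : CyclotomicField 3 ℚ →+* ℂ) (ι : PadicAlgCl 3 ≃+* ℂ)
    (S : Finset (HeightOneSpectrum (𝓞 (CyclotomicField 3 ℚ))))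
    (c₀ : CyclotomicField 3 ℚ ≃ₐ[ℚ] CyclotomicField 3 ℚ)
    (ϖ : HeightOneSpectrum (𝓞 (CyclotomicField 3 ℚ)) → 𝓞 (CyclotomicField 3 ℚ)),
    c₀ ≠ 1 ∧
    (∀ 𝔭 ∉ S, 𝔭.asIdeal = Ideal.span {ϖ 𝔭} ∧ ϖ 𝔭 - 1 ∈ Ideal.span {(3 : 𝓞 (CyclotomicField 3 ℚ))}) ∧
    OrdPolarizedTower art hcpt ι c₀ S (fun 𝔭 => e (↑(picardTrace f 𝔭 * ϖ 𝔭)))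

/-- **The aligned μ-ordinary class at `f`-level** (lead c2; the re-route's case split): some twisted Picard witness
`ρ` for `f` passes the aligned guard relative to `art`. -/
def MuOrdinaryClass (art : ArtinData) (f : ℤ[X]) : Prop :=
  ∃ (ι : PadicAlgCl 3 ≃+* ℂ) (e : CyclotomicField 3 ℚ →+* ℂ)
    (S₀ : Finset (HeightOneSpectrum (𝓞 (CyclotomicField 3 ℚ))))
    (ϖ : HeightOneSpectrum (𝓞 (CyclotomicField 3 ℚ)) → 𝓞 (CyclotomicField 3 ℚ))
    (ρ : FramedGaloisRep (CyclotomicField 3 ℚ) (PadicAlgCl 3) 3),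
    TwistedPicardWitness f ι e S₀ ϖ ρ ∧ MuOrdinaryGaloisGuard art ρ

/-! ## 3. The three open registered stub statements -/

/-- **`OrdinaryPolarizedTwistedTowerDebt`** = the registered `stub_ordinaryPolarizedTwistedTower` (Stub 3ᵒʳᵈ, reshape
r6/r7) VERBATIM: THE INTERFACE DEBT with its ordinary avatar, guarded.  For generic `f`, `ι` adapted to the place
`𝔐`, a twisted Picard witness `ρ` passing the aligned guard, and the typed slope-free tower of the crux hypothesis: a
complex conjugation `c₀ ≠ 1`, a level `S' ⊇ S ∪ S₀` and an ORDINARY exactly `c₀`-polarized tower for the twisted traces.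
As typed it does NOT follow from the slope-free unpolarized tower (a `3`-adic `GL₃ → U(3)` descent plus ordinarity of
a non-classical limit point — 13757-sized); it is the identity once the planner restates BOTH 13757's conclusion and
13758's hypothesis as `OrdTwistedPolarizedLimitHypothesis`.  Not to be staffed. -/
def OrdinaryPolarizedTwistedTowerDebt : Prop :=
    ∀ (f : ℤ[X]) (hcpt : isCompact_glFiniteIntegralLevel 3 (CyclotomicField 3 ℚ)),
      f.natDegree = 4 → (f.map (Int.castRingHom ℚ)).Separable →
      12 ∣ Nat.card (f.map (Int.castRingHom ℚ)).Gal →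
    ∀ (art : ArtinData) (ι : PadicAlgCl 3 ≃+* ℂ) (e : CyclotomicField 3 ℚ →+* ℂ)
      (𝔐 : Ideal (integralClosure ℤ ℂ))
      (S S₀ : Finset (HeightOneSpectrum (𝓞 (CyclotomicField 3 ℚ))))
      (ϖ : HeightOneSpectrum (𝓞 (CyclotomicField 3 ℚ)) → 𝓞 (CyclotomicField 3 ℚ))
      (ρ : FramedGaloisRep (CyclotomicField 3 ℚ) (PadicAlgCl 3) 3),
      𝔐.IsMaximal → (3 : integralClosure ℤ ℂ) ∈ 𝔐 →
      (∀ (z : integralClosure ℤ ℂ) (k : ℕ),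
        (∃ u : integralClosure ℤ ℂ, u ∉ 𝔐 ∧ u * z ∈ Ideal.span {(3 : integralClosure ℤ ℂ) ^ k}) →
        ‖ι.symm (z : ℂ)‖ ≤ ((3 : ℝ)⁻¹) ^ k) →
      (∀ 𝔭 ∉ S₀,
        (𝔭.asIdeal = Ideal.span {ϖ 𝔭} ∧
          ϖ 𝔭 - 1 ∈ Ideal.span {(3 : 𝓞 (CyclotomicField 3 ℚ))}) ∧
        ρ.IsUnramifiedAt 𝔭 ∧
        ∀ 𝔓 ∈ 𝔭.primesAbove, ∀ τ : Field.absoluteGaloisGroup (CyclotomicField 3 ℚ),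
          IsArithFrobAt (𝓞 (CyclotomicField 3 ℚ)) τ 𝔓 →
            FramedRep.trace ρ τ⁻¹ = ι.symm (e (↑(picardTrace f 𝔭 * ϖ 𝔭)))) →
      MuOrdinaryGaloisGuard art ρ →
      (∀ k : ℕ, ∃ P : CuspidalAutomorphicRepData 3 (CyclotomicField 3 ℚ) hcpt,
        P.1.IsRegularAlgebraic ∧
        ∀ 𝔭 ∉ S, ∃ (α : Multiset ℂ) (t u : integralClosure ℤ ℂ), P.1.HasSatakeParamAt 𝔭 α ∧
          (t : ℂ) = (𝔭.residueCard : ℂ) * α.sum - e (picardTrace f 𝔭) ∧ u ∉ 𝔐 ∧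
          u * t ∈ Ideal.span {(3 : integralClosure ℤ ℂ) ^ k}) →
    ∃ (c₀ : CyclotomicField 3 ℚ ≃ₐ[ℚ] CyclotomicField 3 ℚ)
      (S' : Finset (HeightOneSpectrum (𝓞 (CyclotomicField 3 ℚ)))), c₀ ≠ 1 ∧ S ⊆ S' ∧ S₀ ⊆ S' ∧
      OrdPolarizedTower art hcpt ι c₀ S' (fun 𝔭 => e (↑(picardTrace f 𝔭 * ϖ 𝔭)))

/-- **`TwoWallOrdinaryClassicalityLinked`** = the registered `stub_twoWallOrdinaryClassicalityOrd` (Stub 5ᵒʳᵈ, v2 of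
reshape r9) VERBATIM: THE HEART, two-wall ORDINARY classicality, LINKED form — THE ONE OPEN THEOREM of the line and
the statement to promote.  For generic `f`, `ι, e`, a twisted Picard witness `(S₀, ϖ, ρ)`, an ORDINARY `c₀`-polarized
tower for the twisted traces off `S_K ⊇ S₀` (avatars `r_k` ordinary at `λ` of a dominant weight), the CM field
`L = K(√-2)` (`s² = -2`, involution `c` with `c|_K = c₀ ≠ 1`, `ρ|_{Γ_L}` absolutely irreducible, level
`S_L ⊇ {w ∣ 3} ∪ {w ∣ S₀} ∪ {w ∣ S_K}`) and the base-change MAP of the landed `stub_baseChangeToL_linked` on tower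
members (an unramified strong lift `P_L`, Galois-compatible with `r|_{Γ_L}` off `S_L`, trace bound on `Γ_L`): THEN `ρ` is
automorphic over `K` — a cuspidal L-algebraic `π'` on `GL₃(𝔸_K)` with `ρ` unramified and of arithmetic-Frobenius
characteristic polynomial `arithFrobPolyOfSatake ι q 1 α` off a finite `S'`.  Intended proof on the unitary FOURFOLD of
`G' = U(2,1)_{L/L⁺}` at `p = 3` (`L⁺ = ℚ(√6)`, `3` ramified in `L⁺`, split in `L/L⁺`, `G'(ℚ₃) = GL₃(K_λ)`): (i) realization
of `λ'_{C,L}` in the μ-ordinary higher-Hida `H⁰` of the singular weight by the avatars + typicity; (ii) TWO-WALL ORDINARY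
SEN = COUSIN for `Res_{K_λ/ℚ₃} GL₃`, `μ = ((1,0,0),(1,1,0))` — the load-bearing OPEN step (BCGP 2025, arXiv:2502.20645,
§4 for `p` totally split; the authors' announced extension otherwise); (iii) multiplicity one; (iv) Mok transfer and
signed descent `L → K`.  TRUE under reciprocity for `ρ'_C` whatever the hypotheses. -/
def TwoWallOrdinaryClassicalityLinked : Prop :=
    ∀ (art : ArtinData) (f : ℤ[X])
      (hcpt : isCompact_glFiniteIntegralLevel 3 (CyclotomicField 3 ℚ)),
      f.natDegree = 4 → (f.map (Int.castRingHom ℚ)).Separable →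
      12 ∣ Nat.card (f.map (Int.castRingHom ℚ)).Gal →
    ∀ (ι : PadicAlgCl 3 ≃+* ℂ) (e : CyclotomicField 3 ℚ →+* ℂ)
      (S₀ : Finset (HeightOneSpectrum (𝓞 (CyclotomicField 3 ℚ))))
      (ϖ : HeightOneSpectrum (𝓞 (CyclotomicField 3 ℚ)) → 𝓞 (CyclotomicField 3 ℚ))
      (ρ : FramedGaloisRep (CyclotomicField 3 ℚ) (PadicAlgCl 3) 3),
      (∀ v : HeightOneSpectrum (𝓞 (CyclotomicField 3 ℚ)),
        ((3 : ℕ) : 𝓞 (CyclotomicField 3 ℚ)) ∈ v.asIdeal → v ∈ S₀) →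
      (∀ 𝔭 ∉ S₀,
        (𝔭.asIdeal = Ideal.span {ϖ 𝔭} ∧
          ϖ 𝔭 - 1 ∈ Ideal.span {(3 : 𝓞 (CyclotomicField 3 ℚ))}) ∧
        ρ.IsUnramifiedAt 𝔭 ∧
        ∀ 𝔓 ∈ 𝔭.primesAbove, ∀ τ : Field.absoluteGaloisGroup (CyclotomicField 3 ℚ),
          IsArithFrobAt (𝓞 (CyclotomicField 3 ℚ)) τ 𝔓 →
            FramedRep.trace ρ τ⁻¹ = ι.symm (e (↑(picardTrace f 𝔭 * ϖ 𝔭)))) →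
    ∀ (c₀ : CyclotomicField 3 ℚ ≃ₐ[ℚ] CyclotomicField 3 ℚ)
      (S_K : Finset (HeightOneSpectrum (𝓞 (CyclotomicField 3 ℚ)))),
      OrdPolarizedTower art hcpt ι c₀ S_K (fun 𝔭 => e (↑(picardTrace f 𝔭 * ϖ 𝔭))) → S₀ ⊆ S_K →
    ∀ (L : Type) [Field L] [NumberField L] [Algebra (CyclotomicField 3 ℚ) L]
      (s : L) (c : L ≃ₐ[ℚ] L)
      (hcptL : isCompact_glFiniteIntegralLevel 3 L) (S_L : Finset (HeightOneSpectrum (𝓞 L))),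
      NumberField.IsCMField L → c₀ ≠ 1 → s ^ 2 = -2 → Module.finrank (CyclotomicField 3 ℚ) L = 2 →
      c s = -s →
      (∀ x : CyclotomicField 3 ℚ,
        c (algebraMap (CyclotomicField 3 ℚ) L x) = algebraMap (CyclotomicField 3 ℚ) L (c₀ x)) →
      FramedRep.IsAbsolutelyIrreducible (ρ.restrictField L) →
      (∀ w : HeightOneSpectrum (𝓞 L), ((3 : ℕ) : 𝓞 L) ∈ w.asIdeal → w ∈ S_L) →
      (∀ w : HeightOneSpectrum (𝓞 L), w.under (𝓞 (CyclotomicField 3 ℚ)) ∈ S₀ → w ∈ S_L) →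
      (∀ w : HeightOneSpectrum (𝓞 L), w.under (𝓞 (CyclotomicField 3 ℚ)) ∈ S_K → w ∈ S_L) →
      (∀ (k : ℕ) (P : CuspidalAutomorphicRepData 3 (CyclotomicField 3 ℚ) hcpt)
        (r : FramedGaloisRep (CyclotomicField 3 ℚ) (PadicAlgCl 3) 3),
        P.1.IsRegularAlgebraic → P.1.IsConjSelfDualAE c₀ →
        (∀ 𝔭 ∉ S_K, IsGaloisCompatibleAt P.1 ι r 𝔭 ∧
          ∃ (α : Multiset ℂ) (t : integralClosure ℤ ℂ), P.1.HasSatakeParamAt 𝔭 α ∧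
            (t : ℂ) = (𝔭.residueCard : ℂ) * α.sum - e (↑(picardTrace f 𝔭 * ϖ 𝔭)) ∧
            ‖ι.symm (t : ℂ)‖ ≤ ((3 : ℝ)⁻¹) ^ k) →
        ∃ P_L : CuspidalAutomorphicRepData 3 L hcptL,
          P_L.1.IsRegularAlgebraic ∧ P_L.1.IsConjSelfDualAE c ∧
          IsUnramifiedBaseChangeLift P.1 P_L.1 ∧
          (∀ w ∉ S_L, P_L.1.IsUnramifiedAt w ∧ IsGaloisCompatibleAt P_L.1 ι (r.restrictField L) w) ∧
          ∀ g : Field.absoluteGaloisGroup L,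
            ‖FramedRep.trace (r.restrictField L) g - FramedRep.trace (ρ.restrictField L) g‖ ≤
              ((3 : ℝ)⁻¹) ^ k) →
    ∃ (π' : CuspidalAutomorphicRepData 3 (CyclotomicField 3 ℚ) hcpt)
      (S' : Finset (HeightOneSpectrum (𝓞 (CyclotomicField 3 ℚ)))),
      π'.1.IsLAlgebraic ∧
      ∀ 𝔭 ∉ S', ∃ α : Multiset ℂ, π'.1.HasSatakeParamAt 𝔭 α ∧
        ρ.IsUnramifiedAt 𝔭 ∧ ρ.HasFrobCharpolyAt 𝔭 (arithFrobPolyOfSatake ι 𝔭.residueCard 1 α)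

/-- **`BasicRemainder`** = the registered `stub_basicRemainder` (Stub 5rem, reshape r6/r7) VERBATIM: the conceded
λ-BASIC class.  For generic `f`, `ι` adapted to `𝔐`, a twisted Picard witness `ρ` that passes the aligned guard for NO
local Artin datum, and the typed slope-free tower: the `K`-side automorphy conclusion of the heart.  TRUE under
reciprocity; no mechanism in print or announced (no ordinary / finite-slope structure at the ramified rank-one prime;
the CM corner is cubic automorphic induction).  Crux-sized, CONCEDED; under the ordinary restate it leaves this item
and becomes the third branch `BasicLocusAutomorphy`. -/
def BasicRemainder : Prop :=
    ∀ (f : ℤ[X]) (hcpt : isCompact_glFiniteIntegralLevel 3 (CyclotomicField 3 ℚ)),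
      f.natDegree = 4 → (f.map (Int.castRingHom ℚ)).Separable →
      12 ∣ Nat.card (f.map (Int.castRingHom ℚ)).Gal →
    ∀ (ι : PadicAlgCl 3 ≃+* ℂ) (e : CyclotomicField 3 ℚ →+* ℂ)
      (S₀ : Finset (HeightOneSpectrum (𝓞 (CyclotomicField 3 ℚ))))
      (ϖ : HeightOneSpectrum (𝓞 (CyclotomicField 3 ℚ)) → 𝓞 (CyclotomicField 3 ℚ))
      (ρ : FramedGaloisRep (CyclotomicField 3 ℚ) (PadicAlgCl 3) 3),
      (∀ v : HeightOneSpectrum (𝓞 (CyclotomicField 3 ℚ)),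
        ((3 : ℕ) : 𝓞 (CyclotomicField 3 ℚ)) ∈ v.asIdeal → v ∈ S₀) →
      (∀ 𝔭 ∉ S₀,
        (𝔭.asIdeal = Ideal.span {ϖ 𝔭} ∧
          ϖ 𝔭 - 1 ∈ Ideal.span {(3 : 𝓞 (CyclotomicField 3 ℚ))}) ∧
        ρ.IsUnramifiedAt 𝔭 ∧
        ∀ 𝔓 ∈ 𝔭.primesAbove, ∀ τ : Field.absoluteGaloisGroup (CyclotomicField 3 ℚ),
          IsArithFrobAt (𝓞 (CyclotomicField 3 ℚ)) τ 𝔓 →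
            FramedRep.trace ρ τ⁻¹ = ι.symm (e (↑(picardTrace f 𝔭 * ϖ 𝔭)))) →
      (∀ art : ArtinData, ¬ MuOrdinaryGaloisGuard art ρ) →
    ∀ (𝔐 : Ideal (integralClosure ℤ ℂ)) (S : Finset (HeightOneSpectrum (𝓞 (CyclotomicField 3 ℚ)))),
      𝔐.IsMaximal → (3 : integralClosure ℤ ℂ) ∈ 𝔐 →
      (∀ (z : integralClosure ℤ ℂ) (k : ℕ),
        (∃ u : integralClosure ℤ ℂ, u ∉ 𝔐 ∧ u * z ∈ Ideal.span {(3 : integralClosure ℤ ℂ) ^ k}) →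
        ‖ι.symm (z : ℂ)‖ ≤ ((3 : ℝ)⁻¹) ^ k) →
      (∀ k : ℕ, ∃ P : CuspidalAutomorphicRepData 3 (CyclotomicField 3 ℚ) hcpt,
        P.1.IsRegularAlgebraic ∧
        ∀ 𝔭 ∉ S, ∃ (α : Multiset ℂ) (t u : integralClosure ℤ ℂ), P.1.HasSatakeParamAt 𝔭 α ∧
          (t : ℂ) = (𝔭.residueCard : ℂ) * α.sum - e (picardTrace f 𝔭) ∧ u ∉ 𝔐 ∧
          u * t ∈ Ideal.span {(3 : integralClosure ℤ ℂ) ^ k}) →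
    ∃ (π' : CuspidalAutomorphicRepData 3 (CyclotomicField 3 ℚ) hcpt)
      (S' : Finset (HeightOneSpectrum (𝓞 (CyclotomicField 3 ℚ)))),
      π'.1.IsLAlgebraic ∧
      ∀ 𝔭 ∉ S', ∃ α : Multiset ℂ, π'.1.HasSatakeParamAt 𝔭 α ∧
        ρ.IsUnramifiedAt 𝔭 ∧ ρ.HasFrobCharpolyAt 𝔭 (arithFrobPolyOfSatake ι 𝔭.residueCard 1 α)

/-! ## 4. The restated items of the re-route kit (leads c1, c2) -/

/-- **13758ᵒʳᵈ `IrregularClassicalityOrd`** (lead c1): for every choice of local Artin data and every generic `f`, an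
ORDINARY twisted-polarized `3`-adic limit attached to `ρ_C ⊗ ψ` implies automorphy of `C`.  Closed by
`irregularClassicalityOrd_of` (`…Reduction.lean`) modulo the Picard named fact, Arthur–Clozel ×3 and
`TwoWallOrdinaryClassicalityLinked`; a weakening of the target (no refutation room). -/
def IrregularClassicalityOrd : Prop :=
  ∀ (art : ArtinData) (f : ℤ[X]) (hcpt : isCompact_glFiniteIntegralLevel 3 (CyclotomicField 3 ℚ)),
    f.natDegree = 4 → (f.map (Int.castRingHom ℚ)).Separable →
    12 ∣ Nat.card (f.map (Int.castRingHom ℚ)).Gal →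
    OrdTwistedPolarizedLimitHypothesis art f hcpt → AutomorphyConclusion f hcpt

/-- **13757ᵒʳᵈ `MuOrdinaryFamilyRTOrd`** (lead c2's proposed text): for every choice of local Artin data and every
generic `f` IN the aligned μ-ordinary class, residual automorphy in regular weight (as now) ⇒ the ORDINARY
twisted-polarized tower with avatars.  NOT a weakening of the target (it asserts new automorphic data). -/
def MuOrdinaryFamilyRTOrd : Prop :=
  ∀ (art : ArtinData) (f : ℤ[X]) (hcpt : isCompact_glFiniteIntegralLevel 3 (CyclotomicField 3 ℚ)),
    f.natDegree = 4 → (f.map (Int.castRingHom ℚ)).Separable →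
    12 ∣ Nat.card (f.map (Int.castRingHom ℚ)).Gal →
    MuOrdinaryClass art f → ResidualHyp f hcpt → OrdTwistedPolarizedLimitHypothesis art f hcpt

/-- **Third branch `BasicLocusAutomorphy`** (lead c2's proposed text): a generic `f` OUTSIDE the aligned μ-ordinary
class, residually automorphic in regular weight, is automorphic.  Crux-sized; TRUE under reciprocity; a weakening of
the target (no refutation room). -/
def BasicLocusAutomorphy : Prop :=
  ∀ (art : ArtinData) (f : ℤ[X]) (hcpt : isCompact_glFiniteIntegralLevel 3 (CyclotomicField 3 ℚ)),
    f.natDegree = 4 → (f.map (Int.castRingHom ℚ)).Separable →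
    12 ∣ Nat.card (f.map (Int.castRingHom ℚ)).Gal →
    ¬ MuOrdinaryClass art f → ResidualHyp f hcpt → AutomorphyConclusion f hcpt

end

end Summit.Langlands.Langlands.Theorems.IrregularClassicality.SplitRamifiedPrimeSqrt6
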